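import Mathlib
import Summits.Ventures.HodgeRepro.Tier4.Common.CompactOpenLevel
import Summits.Ventures.HodgeRepro.Tier4.Common.RowWeights
import Summits.Ventures.HodgeRepro.Tier4.Common.RowPlane
import Summits.Ventures.HodgeRepro.Tier4.Common.DiscreteImage
import Summits.Ventures.HodgeRepro.Tier4.Common.TorusInfCompact
import Summits.Ventures.HodgeRepro.Tier4.Line1.CocompactReduction
import Summits.Ventures.HodgeRepro.Tier4.Line4.TorusProduct
import Summits.Ventures.HodgeRepro.Tier4.Line4.TorusProductHaar
import Summits.Ventures.HodgeRepro.Tier4.Line4.CentreFinDomain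

/-!
# Tier4/Line4/CentreFinSeesaw — Part 6 (ii)/(iii) of the factorisation chain as THEOREMS on the row planes

Blind re-derivation cell `pub-hodge-repro`, Tier 4 «prove the step» (README §9–§10), seat t4-L2-p2 g4 (prover; plan-4
g3's cut S14501, typer-2 g4's recipe S14612).  `CentreFinDomain` carries the CM input `CentreFinFinite W` («the image
of `Z(k)` in `T_f` meets a compact open subgroup in a finite set») as a displayed hypothesis; here it is PROVED for the
row planes `PlaneData.ofLinesRow q a b ε` under the line's displayed place conditions (every infinite place real and CM
for `q`): typer-2's `Common.compactSpace_infinitePart_subgroupOf_torusT_ofLinesRow` (TorusInfCompact) makes `T_∞`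
compact, so the finite-part projection `finTfHom : T(𝔸) → T_f` is PROPER (`Common.isCompact_preimage_snd_of_compactSpace`
along `torusSplit`), and `Z(k)` is discrete (`Line1.rationalOf_discrete`); hence its image meets the compact open
`K(1) ∩ T_f` in a finite set (`Common.finite_map_inter_of_isCompact_preimage`, DiscreteImage) and is itself discrete
(`Common.discreteTopology_map_of_isCompact_preimage`).  No unit theorem and no printed input: the CM condition enters
only through the compactness of `T_∞`.  Junk test (typer-2 S14612): at a non-CM real place the norm-one curve is a
hyperbola and `T_∞` is not compact — `hcm` is used at every place.

HC_CM is NOT proved by anyone in this repository.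
-/

set_option autoImplicit false
noncomputable section
namespace Summit.Ventures.HodgeRepro.Tier4.Line4
open Summit.Ventures.HodgeRepro.Tier4 Summit.Ventures.HodgeRepro.Tier4.Common
  Summit.Ventures.HodgeRepro.Tier4.Line1 MeasureTheory
open scoped ComplexConjugate Topology Pointwise NNReal

/-! ## Part 6 (ii)/(iii) ON THE SEESAW PLANE — `CentreFinFinite` and the discreteness of `centreFin` as THEOREMS
(typer-2 g4's recipe S14612: `T_∞` compact under `hreal`/`hcm` (TorusInfCompact) + `Z(k)` discrete ⇒ the finite-part
projection is proper on `Z(k)`; DiscreteImage) -/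

section Seesaw
open NumberField
variable {k : Type} [Field k] [NumberField k] (W : PlaneData k)

/-- `Z(k)` is discrete in `T(𝔸)` (a subgroup of the discrete `T(k)`, L1's `rationalOf_discrete`). -/
theorem discreteTopology_rationalCentreT : DiscreteTopology (rationalCentreT W) :=
  haveI := rationalOf_discrete W (torusT W)
  DiscreteTopology.of_subset (s := (rationalOf W (torusT W) : Set (torusT W)))
    (t := (rationalCentreT W : Set (torusT W))) inferInstance (rationalCentreT_le W)

/-- The level subgroup `K(N)` pulled back to `T_f`. -/
def levelFin (N : ℕ) : Subgroup (torusFin W) := ((levelK W N).subgroupOf (torusT W)).subgroupOf (torusFin W)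

/-- The inclusion `T_f → G(𝔸_f)` is continuous. -/
theorem continuous_torusFin_to_finitePart :
    Continuous (fun x : torusFin W => (⟨((x : torusT W) : GA W), x.2⟩ : finitePart W)) :=
  Continuous.subtype_mk (continuous_subtype_val.comp continuous_subtype_val) _

/-- `K(N) ∩ T_f` is open in `T_f` (the preimage of the open `K(N) ≤ G(𝔸_f)` under the inclusion). -/
theorem isOpen_levelFin {N : ℕ} (hN : N ≠ 0) : IsOpen (levelFin W N : Set (torusFin W)) := by
  have h := (isCompactOpenIn_levelK W hN).isOpen
  exact (h.preimage (continuous_torusFin_to_finitePart W))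

/-- `K(N) ∩ T_f` is compact in `T_f` (a closed subset of the compact `K(N)`). -/
theorem isCompact_levelFin {N : ℕ} (hN : N ≠ 0) : IsCompact (levelFin W N : Set (torusFin W)) := by
  rw [Subtype.isCompact_iff, Subtype.isCompact_iff]
  have hset : Subtype.val '' (Subtype.val '' (levelFin W N : Set (torusFin W))) =
      (levelK W N : Set (GA W)) ∩ (torusT W : Set (GA W)) := by
    ext g
    constructor
    · rintro ⟨t, ⟨x, hx, hxt⟩, rfl⟩
      refine ⟨?_, t.2⟩
      rw [← hxt]
      exact Subgroup.mem_subgroupOf.1 (Subgroup.mem_subgroupOf.1 hx)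
    · rintro ⟨hgK, hgT⟩
      refine ⟨⟨g, hgT⟩, ⟨⟨⟨g, hgT⟩, Subgroup.mem_subgroupOf.2 (levelK_le_finitePart W N hgK)⟩, ?_, rfl⟩, rfl⟩
      exact Subgroup.mem_subgroupOf.2 (Subgroup.mem_subgroupOf.2 hgK)
  rw [hset]
  exact (isCompact_levelK W hN).inter_right (Common.isClosed_torusT W)

/-- **`Z(k) → T_f` is proper when `T_∞` is compact**: preimages of compacts under `finTfHom` are compact. -/
theorem isCompact_preimage_finTfHom [CompactSpace (torusInf W)] {K : Set (torusFin W)} (hK : IsCompact K) :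
    IsCompact (finTfHom W ⁻¹' K) :=
  Common.isCompact_preimage_snd_of_compactSpace (torusSplit W).toHomeomorph hK

/-- **`CentreFinFinite` is a THEOREM when `T_∞` is compact**: `Z(k)` is discrete and `finTfHom` is proper, so the image
meets the compact open `K(1) ∩ T_f` in a finite set. -/
theorem centreFinFinite_of_compactSpace_torusInf [CompactSpace (torusInf W)] : CentreFinFinite W := by
  haveI := discreteTopology_rationalCentreT W
  haveI : T2Space (torusFin W) := t2Space_torusFin W
  refine ⟨levelFin W 1, isOpen_levelFin W one_ne_zero, isCompact_levelFin W one_ne_zero, ?_⟩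
  exact Common.finite_map_inter_of_isCompact_preimage (rationalCentreT W) (finTfHom W)
    (isCompact_preimage_finTfHom W (isCompact_levelFin W one_ne_zero))

/-- **`centreFin` is discrete when `T_∞` is compact** (directly, DiscreteImage). -/
theorem discreteTopology_centreFin_of_compactSpace_torusInf [CompactSpace (torusInf W)] :
    DiscreteTopology (centreFin W) := by
  haveI := discreteTopology_rationalCentreT W
  haveI : T2Space (torusFin W) := t2Space_torusFin W
  haveI : LocallyCompactSpace (torusFin W) := locallyCompact_torusFin W
  exact Common.discreteTopology_map_of_isCompact_preimage (rationalCentreT W) (finTfHom W)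
    fun _ hK => isCompact_preimage_finTfHom W hK

end Seesaw

section SeesawPlane
open NumberField
variable {k : Type} [Field k] [NumberField k] (q : QuadData k) (a b ε : k)

/-- `T_∞` is compact for a row plane under the CM place conditions (typer-2's TorusInfCompact, by name; `torusInf`
is that subgroup by definition). -/
theorem compactSpace_torusInf_ofLinesRow (ha : a ≠ 0) (hb : b ≠ 0) (hε : ε ≠ 0)
    (hreal : ∀ w : InfinitePlace k, w.IsReal) (hcm : ∀ w, IsCMAt q w) :
    CompactSpace (torusInf (PlaneData.ofLinesRow q a b ε)) :=
  Common.compactSpace_infinitePart_subgroupOf_torusT_ofLinesRow q a b ε ha hb hε hreal hcm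

/-- **The CM input of Part 6 (ii) is a THEOREM on the row planes** (every infinite place real and CM for `q`). -/
theorem centreFinFinite_ofLinesRow (ha : a ≠ 0) (hb : b ≠ 0) (hε : ε ≠ 0)
    (hreal : ∀ w : InfinitePlace k, w.IsReal) (hcm : ∀ w, IsCMAt q w) :
    CentreFinFinite (PlaneData.ofLinesRow q a b ε) :=
  haveI := compactSpace_torusInf_ofLinesRow q a b ε ha hb hε hreal hcm
  centreFinFinite_of_compactSpace_torusInf _

/-- **`centreFin` is discrete on the row planes.** -/
theorem discreteTopology_centreFin_ofLinesRow (ha : a ≠ 0) (hb : b ≠ 0) (hε : ε ≠ 0)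
    (hreal : ∀ w : InfinitePlace k, w.IsReal) (hcm : ∀ w, IsCMAt q w) :
    DiscreteTopology (centreFin (PlaneData.ofLinesRow q a b ε)) :=
  haveI := compactSpace_torusInf_ofLinesRow q a b ε ha hb hε hreal hcm
  discreteTopology_centreFin_of_compactSpace_torusInf _

end SeesawPlane

end Summit.Ventures.HodgeRepro.Tier4.Line4

end
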